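import Summits.BirchSwinnertonDyer.BirchSwinnertonDyer.Theorems.ResidualThetaTransportAtTwoSignedMuVanishingAtTwoPlusTrivialPlusSelmer
import Summits.BirchSwinnertonDyer.BirchSwinnertonDyer.Theorems.ThetaPartnerAtTwoSignedControlAtTwoStubPlusHondaSystemTwo
import Summits.BirchSwinnertonDyer.BirchSwinnertonDyer.Theorems.ByReductionTypeAtTwoOrdKatoHalfIsogenyMu
import Literature.NumberTheory.EllipticCurves.LeadingTermPPartProofs
import Literature.NumberTheory.EllipticCurves.BSDRootNumberSmallConductorProofs
import Literature.NumberTheory.EllipticCurves.MordellWeilRankZeroProofs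
import HarnessLib

/-!
# Crux `SupersingularRankZeroAtTwo` (item stmt-BirchSwinnertonDyer-19097, route `ByReductionTypeAtTwo`, rung K4), UNIT-ANCHOR road:
# THE ANCHOR IN THE KERNEL — `r_an(A) = 0` ∧ `2 ∤ #Ш(A)` ∧ `2 ∤ ∏ c_ℓ(A)` ∧ HONDA⁺@2 (PROVED) ⟹ `Sel⁺(A/ℚ_∞) = 0` ⟹ `X⁺_A = 0`, `μ = λ = 0`
# (seat `bsd-2adic-ss-1x` GEN 7; companion of `…UnitAnchorTP2Items`, which consumes it in the pair door)

HONEST FRAMING (cells `bsd-2adic` / `bsd-wall`; HUMAN RULINGS D-0036/D-0054/D-0074): THEOREMS ONLY — no definition, no named fact, no instance,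
no `sorry`; every hypothesis is displayed; closes no item; BSD is NOT proved by any of this. PARTITION (D-0054): X5@2 good-ss `a₂ = 0` UNIT-ANCHOR
sub-row × `p = 2` — types-the-object-of (the anchor side of the transport); bears_on K4 19097 · K4-TP2 20309's stub HONDA⁺@2 (PROVED by seat
tp2-p3-w2, `Cruxes.SignedControlAtTwo.EulerChar.stub_plusHondaSystemTwo`; consumed through its CM-free core `SignedEC.PlusLayer.plusHondaSystemTwo_padic`).

WHY. GEN 4–6's unit-anchor doors (`SSUnitAnchor.torsion_and_charIdeal_eq_top_and_mu_eq_zero_of_unitZone` p558810 and every consumer up to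
`…UnitAnchorTP2ByName` p589842) made `X⁺_A` torsion with `char = Λ` from the signed Euler-characteristic formula (2′) READ AT the anchor `A` — a
research ∀-clause of the seat's own wording (`hECA`). Cell bsd-wall's seat rtt-p4-w2 (p588465 `…SignedMuVanishingAtTwoPlusTrivialPlusSelmer`,
ns `SignedMuAtTwo`) proved Greenberg's Prop. 3.8 for Kobayashi's signed structure with NO Euler characteristic: INJ⁺@2 ∧ `E(ℚ)[2] = 0` ∧
`Sel_{2^∞}(E/ℚ) = 0` ∧ `2 ∤ Tam` ⟹ `(Sel⁺_∞)^γ = 0` ⟹ `Sel⁺_∞ = 0`, INJ⁺@2 ⟸ HONDA⁺@2 — and HONDA⁺@2 is meanwhile a THEOREM (tp2-p3-w2's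
`SignedEC.PlusLayer.plusHondaSystemTwo_padic`, transported to `ℚ_v` with (GEN₀) by tp2-p3-w3's `SignedEC.plusHondaSystem_adicCompletion_of_padic_nonDiv`).
Hence, in the kernel: `selmerGroupPInfty_two_eq_bot_of_oddSha` (`r_an = 0` by GZK ⟹ `A(ℚ)`, `Ш(A)` finite; `2 ∤ #Ш` ⟹ `Sel_{2^∞}(A/ℚ) = 0`),
`signedSelmerInfty_two_eq_bot_of_selmerGroupPInfty_eq_bot` (ANY good-ss `a₂ = 0` curve: `Sel_{2^∞} = 0` ∧ `2 ∤ Tam` ⟹ `Sel⁺_∞ = 0`),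
`signedSelmerInfty_two_eq_bot_of_unitZone`, `package_of_signedSelmerInfty_eq_bot` (`X = 0`, f.g., torsion, `μ = λ = 0`), `anchorPackage_of_unitZone`.
NO (2′), NO Kim term, NO `L`-value, NO modularity at `A`, NO CM / non-CM hypothesis. (A route-independent twin of p588465 §1–§2 was refused by the
gate's dedup lint, so this file imports p588465 and carries its theses-cone warning.)

References: [GreenbergLNM1716] §3 Prop. 3.8 (pp. 95–96), §1 p. 54, §4 p. 103; [Kobayashi2003] Def. 1.1, §8.4 (Lemma 8.9, Props. 8.11–8.12), Thm. 1.2,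
Thm. 9.3; [BDKim2013] proof of Cor. 3.15 (pp. 199–200); [Washington1997] §13.2.
-/

set_option autoImplicit false
-- the Theorems namespace of this sub repeats the summit name by design (D-0017 nested layout)
set_option linter.dupNamespace false

noncomputable section

open scoped Classical NumberField

open NumberField IsDedekindDomain WeierstrassCurve Literature.NumberTheory.EllipticCurves
  Literature.NumberTheory.EllipticCurves.Rank1Residual Literature.NumberTheory.EllipticCurves.Kobayashi2003
  Literature.NumberTheory.EllipticCurves.IwasawaDual ZpExtension

namespace Summit.BirchSwinnertonDyer.BirchSwinnertonDyer.Theorems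
namespace SSUnitAnchor

/-! ## §1 The anchor in the kernel: `Sel_{2^∞}(A/ℚ) = 0` and HONDA⁺@2 ⟹ `Sel⁺(A/ℚ_∞) = 0` ⟹ `X⁺_A = 0` -/

section Anchor

variable (A : WeierstrassCurve ℚ) [A.IsElliptic] [A.IsGloballyMinimal]

omit [A.IsGloballyMinimal] in
/-- **`Sel_{2^∞}(A/ℚ) = 0` on the unit zone.** `A/ℚ` of analytic rank `0` (so `A(ℚ)` and `Ш(A)` are finite: Gross–Zagier–Kolyvagin, `hGZK`)
with `2 ∤ #Ш(A)`: `#Sel_{2^∞}(A/ℚ) = #Ш(A)[2^∞] = 2^{ord₂ #Ш(A)} = 1` (tree `natCard_selmerGroupPInfty_eq_natCard_primaryComponent_sha`).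
[cite: GreenbergLNM1716, §1 p. 54 and §4 p. 103] -/
theorem selmerGroupPInfty_two_eq_bot_of_oddSha (hGZK : rank_eq_analyticRank_of_analyticRank_le_one)
    (hAr : A.analyticRank = 0) (hSha : ¬ 2 ∣ A.shaOrder) : A.selmerGroupPInfty 2 = ⊥ := by
  have h0 : A.mordellWeilRank = 0 := (hGZK A (by omega)).1.trans hAr
  haveI : Finite A.toAffine.Point := A.mordellWeilRank_eq_zero_iff_finite.mp h0
  haveI : Finite A.sha := (hGZK A (by omega)).2
  have hv : (Nat.card A.sha).factorization 2 = 0 := by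
    rw [Nat.factorization_def _ Nat.prime_two]
    exact padicValNat.eq_zero_of_not_dvd hSha
  apply AddSubgroup.eq_bot_of_card_eq
  rw [A.natCard_selmerGroupPInfty_eq_natCard_primaryComponent_sha 2, card_addPrimaryComponent_eq_pow, hv, pow_zero]

/-- **`Sel⁺(E/ℚ_∞) = 0` with the local input DISCHARGED, for `a₂ = 0`.** `E/ℚ` globally minimal, good supersingular at `2` with `a₂(E) = 0`,
`κ` cyclotomic: `Sel_{2^∞}(E/ℚ) = 0` ∧ `2 ∤ ∏ c_ℓ(E)` ⟹ `Sel⁺(E/ℚ_∞) = 0`. Cell bsd-wall's `SignedMuAtTwo.signedSelmerInfty_two_eq_bot_of_honda`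
(rtt-p4-w2, p588465: Greenberg's Prop. 3.8 for the signed structure — INJ⁺@2 + `E(ℚ)[2] = 0` + `Sel_{2^∞} = 0` + `2 ∤ Tam` ⟹ `(Sel⁺_∞)^γ = 0` ⟹
`Sel⁺_∞ = 0`, INJ⁺@2 ⟸ HONDA⁺@2) with its hypothesis HONDA⁺@2 DISCHARGED: tp2-p3-w2's `SignedEC.PlusLayer.plusHondaSystemTwo_padic` (the plus Honda
system on the cyclotomic `ℤ₂`-tower of `ℚ₂` for every embedding `ι` — the CM-free core of the PROVED K4-TP2 stub `stub_plusHondaSystemTwo`)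
transported to `ℚ_v` with (GEN₀) by tp2-p3-w3's `SignedEC.plusHondaSystem_adicCompletion_of_padic_nonDiv`. No CM / non-CM or rank hypothesis;
no (2′), no Kim term, no `L`-value, no modularity. [cite: Kobayashi2003, §8.4 (Lemma 8.9, Props. 8.11–8.12) and Thm. 9.3]
[cite: GreenbergLNM1716, §3 Prop. 3.8 (pp. 95–96)] -/
theorem signedSelmerInfty_two_eq_bot_of_selmerGroupPInfty_eq_bot (hAss : GoodSS A 2) (hAa : A.frobeniusTrace 2 = 0)
    {κ : ZpExtension ℚ 2} (hκ : κ.IsCyclotomic) (hSel : A.selmerGroupPInfty 2 = ⊥) (hTam : ¬ 2 ∣ A.tamagawaProduct) :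
    signedSelmerInfty A κ 1 = ⊥ :=
  SignedMuAtTwo.signedSelmerInfty_two_eq_bot_of_honda A hAss hκ
    (fun v hv ↦ SignedEC.plusHondaSystem_adicCompletion_of_padic_nonDiv A hAss κ v hv
      fun ι ↦ SignedEC.PlusLayer.plusHondaSystemTwo_padic A hAss hAa κ hκ ι)
    hSel hTam

/-- **`Sel⁺(A/ℚ_∞) = 0` on the unit zone, IN THE KERNEL.** `A/ℚ` globally minimal, good supersingular at `2` with `a₂(A) = 0`, of analytic
rank `0`, with `2 ∤ #Ш(A)` and `2 ∤ ∏ c_ℓ(A)`; `κ` the cyclotomic `ℤ₂`-extension. Then Kobayashi's plus Selmer group of `A` over `ℚ_∞` is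
ZERO (`signedSelmerInfty_two_eq_bot_of_selmerGroupPInfty_eq_bot` on `selmerGroupPInfty_two_eq_bot_of_oddSha`).
[cite: Kobayashi2003, §8.4 and Thm. 9.3] [cite: GreenbergLNM1716, §3 Prop. 3.8 (pp. 95–96), §1 p. 54] -/
theorem signedSelmerInfty_two_eq_bot_of_unitZone (hGZK : rank_eq_analyticRank_of_analyticRank_le_one)
    (hAr : A.analyticRank = 0) (hAss : GoodSS A 2) (hAa : A.frobeniusTrace 2 = 0)
    (hTam : ¬ 2 ∣ A.tamagawaProduct) (hSha : ¬ 2 ∣ A.shaOrder)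
    (κ : ZpExtension ℚ 2) (hκ : κ.IsCyclotomic) : signedSelmerInfty A κ 1 = ⊥ :=
  signedSelmerInfty_two_eq_bot_of_selmerGroupPInfty_eq_bot A hAss hAa hκ
    (selmerGroupPInfty_two_eq_bot_of_oddSha A hGZK hAr hSha) hTam

omit [A.IsElliptic] [A.IsGloballyMinimal] in
/-- **`X = 0` ⟹ the whole `Λ`-package**: a Pontryagin-dual datum of `Sel^ε(A/ℚ_∞)` with `Sel^ε(A/ℚ_∞) = 0` has `X = 0` (`Subsingleton`; bsd-wall's
`SignedMuAtTwo.subsingleton_X_of_signedSelmerInfty_eq_bot`), `X` finitely generated and `Λ`-torsion with `μ(X) = 0` (`SignedMuAtTwo.*`), and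
`λ(X) = 0` (`KatoHalfIsogeny.lambdaInvariant_eq_zero_of_nsmul_eq_zero`). [cite: Kobayashi2003, Def. 1.1 and Thm. 1.2] [cite: Washington1997, §13.2] -/
theorem package_of_signedSelmerInfty_eq_bot {ε : ℤˣ} {κ : ZpExtension ℚ 2} {γ : Field.absoluteGaloisGroup ℚ}
    (D : SignedSelmerDualData A κ γ ε) (hbot : signedSelmerInfty A κ ε = ⊥) :
    Subsingleton D.X ∧ Module.Finite (IwasawaAlgebra 2) D.X ∧ Module.IsTorsion (IwasawaAlgebra 2) D.X ∧ D.mu = 0 ∧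
      lambdaInvariant 2 D.X = 0 := by
  haveI hsub : Subsingleton D.X := SignedMuAtTwo.subsingleton_X_of_signedSelmerInfty_eq_bot D hbot
  haveI hfin : Module.Finite (IwasawaAlgebra 2) D.X := SignedMuAtTwo.moduleFinite_of_signedSelmerInfty_eq_bot D hbot
  obtain ⟨hT, hμ⟩ := SignedMuAtTwo.isTorsion_and_mu_eq_zero_of_signedSelmerInfty_eq_bot D hbot
  refine ⟨hsub, hfin, hT, hμ, ?_⟩
  exact KatoHalfIsogeny.lambdaInvariant_eq_zero_of_nsmul_eq_zero 2 one_ne_zero fun x ↦ Subsingleton.elim _ _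

/-- **THE UNIT-ZONE ANCHOR PACKAGE, IN THE KERNEL (supersedes GEN 4's `torsion_and_charIdeal_eq_top_and_mu_eq_zero_of_unitZone`, p558810, which
took (2′) at `A`).** Same hypotheses as `signedSelmerInfty_two_eq_bot_of_unitZone`; `γ` any element (the datum's). Then for EVERY Pontryagin-dual
datum `D` of `Sel⁺(A/ℚ_∞)`: `X⁺_A = 0` (`Subsingleton D.X`), hence `X⁺_A` is finitely generated, `Λ`-torsion, `μ(X⁺_A) = 0` and `λ(X⁺_A) = 0`.
[cite: Kobayashi2003, Def. 1.1 and Thm. 1.2] [cite: GreenbergLNM1716, §3 Prop. 3.8] [cite: Washington1997, §13.2] -/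
theorem anchorPackage_of_unitZone (hGZK : rank_eq_analyticRank_of_analyticRank_le_one)
    (hAr : A.analyticRank = 0) (hAss : GoodSS A 2) (hAa : A.frobeniusTrace 2 = 0)
    (hTam : ¬ 2 ∣ A.tamagawaProduct) (hSha : ¬ 2 ∣ A.shaOrder)
    (κ : ZpExtension ℚ 2) (γ : Field.absoluteGaloisGroup ℚ) (hκ : κ.IsCyclotomic) (D : SignedSelmerDualData A κ γ 1) :
    Subsingleton D.X ∧ Module.Finite (IwasawaAlgebra 2) D.X ∧ Module.IsTorsion (IwasawaAlgebra 2) D.X ∧ D.mu = 0 ∧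
      lambdaInvariant 2 D.X = 0 :=
  package_of_signedSelmerInfty_eq_bot A D (signedSelmerInfty_two_eq_bot_of_unitZone A hGZK hAr hAss hAa hTam hSha κ hκ)

end Anchor

end SSUnitAnchor
end Summit.BirchSwinnertonDyer.BirchSwinnertonDyer.Theorems

end
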